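import Literature.Barriers.QuantumAdvantage.PPolyOraclesThm76
import Literature.Computability.Cryptography.LubyRackoff
import Literature.Computability.Complexity.PPolyReductions
import Literature.Computability.Complexity.StackBricksArith
import Literature.Computability.Complexity.SplitOnesBricks
import HarnessLib

/-!
# Aaronson–Chen 2017, Thm. 7.6: "each `f_n` has a polynomial-size circuit, and consequently `O ∈ P/poly`" — the `P/poly` leaf, proved

Sibling proof file of `Literature/Barriers/QuantumAdvantage/PPolyOraclesThm76.lean`. It DISCHARGES
the leaf `aaronsonChen2017_thm76_ppoly` of that file (the last sentence of the printed proof of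
Thm. 7.6 of S. Aaronson, L. Chen, CCC 2017, arXiv:1612.05903, p. 30: "Finally, note that each `f_n`
has a polynomial-size circuit, and consequently `O ∈ P/poly`"): for an efficiently computable PRP
`F`, every assignment `W` whose levels are identity, `PRP^raw` or `PRF^mod` tables (`IsACTable`)
encodes through `acLang` a language in `PPoly`.

**The argument** (Arora–Barak 2009, Thm. 6.18, "`P/poly` = polynomial time with polynomial
advice", in the tree as `PPoly_eq_polyAdvice_P_holds`): the advice for input length `t` is the list
of the RECORDS of the levels `m ≤ t` — a tag (identity / `PRP^raw` / `PRF^mod`), the block length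
`1^{ℓ m}`, the key `k_m` and the modulus `a_m` in binary (`ACEval.advOf`, a coded list
`OracleCompose.body` read by `HashBricks.nthItemFn_body`, of polynomial length by the
bounds of `IsEfficientFamily`, `length_advOf_le`) — and ONE polynomial-time machine (`outF`,
assembled from the tree's `FP` string bricks, no new machine) decides, on `⟨s, advice⟩`, whether
`s = 1^m 0 1^j 0 x` is a header (`validF`, re-encoding and `eqPairFn`), fetches record `m`
(`HashBricks.nthItemFn`), computes the level-`m` value of `x` — `x` itself off the block length or
for the identity, `F m k x` through the given machine of `F` (`LubyRackoff.strFn`), or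
`F m k (x mod a)` with the binary remainder brick `Brick.remFn` padded to `ℓ m` bits
(`xredF_spec`, `take_encodeNat_append_replicate`) — and outputs its bit `j` (`bitAtFn`):
`outF_hdr`. A header of level `m` is longer than `m`, so record `m` is in the advice; a query
accepted by the machine is a header (`eq_hdr_of_validF`), and non-headers are not in `acLang W`.

## Main statements

* `outF F ∈ FP` (`outF_mem_FP`), `{w | outF F w = [true]} ∈ P` (`outLang_mem_P`) and the
  semantics on headers `outF_hdr` (bit `j` of `levelValue W m x`);
* `length_advOf_le` — the advice has polynomial length;
* `acLang_mem_polyAdvice_P` — `acLang W ∈ P/poly-advice` for `IsACTable` assignments;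
* `aaronsonChen2017_thm76_ppoly_holds : aaronsonChen2017_thm76_ppoly`, and the assembly
  `aaronsonChen2017_thm76_of_prp_of_leaves₃` (three leaves left: `PRF^mod` security, the quantum
  machine, the `BPP^O` compilation).

## References

* [AaronsonChen2017] arXiv:1612.05903, Thm. 7.6 (proof, last sentence, p. 30).
* [AroraBarak2009] S. Arora, B. Barak, *Computational Complexity* (2009), Def. 6.5, Def. 6.16 and
  Thm. 6.18 (`P/poly` via advice), §1.3 (closure of polynomial time under composition).
-/

noncomputable section

namespace Literature.Barriers.QuantumAdvantage

open _root_.Computability Literature.Computability.Complexity Literature.Computability.Cryptography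
open Literature.Computability.Complexity.Brick Literature.Computability.Complexity.Plumb
  Literature.Computability.Complexity.OracleCompose Literature.Computability.Complexity.HashBricks
  Literature.Computability.Cryptography.LubyRackoff Polynomial

/-! ### Binary numerals padded to a fixed width -/

/-- **Padding the canonical numeral to width `ℓ`**: for `r < 2^ℓ`, the first `ℓ` bits of
`encodeNat r` followed by zeros are the width-`ℓ` little-endian digits `natBits ℓ r` (two strings of
equal length and value coincide, `Kannan.eq_of_bitsToNat_eq`). [folklore] -/
theorem take_encodeNat_append_replicate {ℓ r : ℕ} (hr : r < 2 ^ ℓ) :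
    (encodeNat r ++ List.replicate ℓ false).take ℓ = Literature.Computability.Complexity.natBits ℓ r := by
  set l := encodeNat r ++ List.replicate ℓ false with hl
  have hlen : ℓ ≤ l.length := by simp [hl]
  have hT : (l.take ℓ).length = ℓ := by rw [List.length_take, min_eq_left hlen]
  have hval : bitsToNat l = r := by
    rw [hl, bitsToNat_append, bitsToNat_encodeNat, bitsToNat_replicate_false, mul_zero, add_zero]
  have hsplit : bitsToNat l = bitsToNat (l.take ℓ) + 2 ^ ℓ * bitsToNat (l.drop ℓ) := by
    conv_lhs => rw [← List.take_append_drop ℓ l]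
    rw [bitsToNat_append, hT]
  have hlt : bitsToNat (l.take ℓ) < 2 ^ ℓ := by
    have := bitsToNat_lt (l.take ℓ); rwa [hT] at this
  have hD : bitsToNat (l.drop ℓ) = 0 := by
    by_contra hne
    have h1 : 1 ≤ bitsToNat (l.drop ℓ) := Nat.one_le_iff_ne_zero.2 hne
    have : 2 ^ ℓ ≤ bitsToNat l := by rw [hsplit]; nlinarith [Nat.two_pow_pos ℓ]
    rw [hval] at this
    omega
  have hTval : bitsToNat (l.take ℓ) = r := by rw [← hval, hsplit, hD]; simp
  apply Kannan.eq_of_bitsToNat_eq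
  · rw [hT, Literature.Computability.Complexity.length_natBits]
  · rw [hTval, Literature.Computability.Complexity.bitsToNat_natBits hr]

/-! ### The advice: one record per level -/

namespace ACEval

/-- The length of a coded list `OracleCompose.body [r₀, r₁, …] = ⟨r₀, ⟨r₁, … ⟨r_t, ε⟩⟩⟩` (read by
`HashBricks.nthItemFn`; the twin `OracleComposition.length_foldr_boolPair` is not importable here).
[folklore] -/
theorem length_body : ∀ rs : List (List Bool),
    (body rs).length = (rs.map fun r => 2 * r.length + 2).sum
  | [] => rfl
  | r :: rs => by
    rw [body_cons, length_boolPair, length_body rs, List.map_cons, List.sum_cons, add_assoc, add_comm 2]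

/-- The record of an identity level (tag `ε`). [folklore] -/
def recId (L : ℕ) : List Bool :=
  boolPair [] (boolPair (ones L) (boolPair [] []))

/-- The record of a `PRP^raw` level (tag `0`): block length and key. [folklore] -/
def recRaw (L : ℕ) (k : List Bool) : List Bool :=
  boolPair [false] (boolPair (ones L) (boolPair k []))

/-- The record of a `PRF^mod` level (tag `1`): block length, key and modulus in binary. [folklore] -/
def recMod (L : ℕ) (k : List Bool) (a : ℕ) : List Bool :=
  boolPair [true] (boolPair (ones L) (boolPair k (encodeNat a)))

variable {F : FunctionEnsemble} {κ ℓ : ℕ → ℕ}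

/-- **The record of level `m`** of an assignment whose levels are identity / `PRP^raw` / `PRF^mod`
tables (keys extracted by choice from `IsACTable`). [cite: AaronsonChen2017, Thm. 7.6 (proof, p. 30)] -/
def recOf (F : FunctionEnsemble) (κ ℓ : ℕ → ℕ) (W : Tables ℓ) (m : ℕ) : List Bool :=
  open scoped Classical in
  if ∃ k : List Bool, k.length = κ m ∧ W m = rawTbl F ℓ m k then
    recRaw (ℓ m) (Classical.epsilon fun k : List Bool => k.length = κ m ∧ W m = rawTbl F ℓ m k)
  else if ∃ p : List Bool × ℕ, p.1.length = κ m ∧ p.2 ∈ zhandryModuli (2 ^ ℓ m) ∧ W m = modTbl F ℓ m p.1 p.2 then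
    recMod (ℓ m)
      (Classical.epsilon fun p : List Bool × ℕ =>
        p.1.length = κ m ∧ p.2 ∈ zhandryModuli (2 ^ ℓ m) ∧ W m = modTbl F ℓ m p.1 p.2).1
      (Classical.epsilon fun p : List Bool × ℕ =>
        p.1.length = κ m ∧ p.2 ∈ zhandryModuli (2 ^ ℓ m) ∧ W m = modTbl F ℓ m p.1 p.2).2
  else recId (ℓ m)

/-- The three shapes of the record of a level, with its witnesses. [folklore] -/
theorem recOf_cases (W : Tables ℓ) (m : ℕ) (hW : IsACTable F κ ℓ m (W m)) :
    (W m = id ∧ recOf F κ ℓ W m = recId (ℓ m)) ∨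
    (∃ k : List Bool, k.length = κ m ∧ W m = rawTbl F ℓ m k ∧ recOf F κ ℓ W m = recRaw (ℓ m) k) ∨
    (∃ (k : List Bool) (a : ℕ), k.length = κ m ∧ a ∈ zhandryModuli (2 ^ ℓ m) ∧
      W m = modTbl F ℓ m k a ∧ recOf F κ ℓ W m = recMod (ℓ m) k a) := by
  classical
  unfold recOf
  by_cases h1 : ∃ k : List Bool, k.length = κ m ∧ W m = rawTbl F ℓ m k
  · rw [if_pos h1]
    have hε := Classical.epsilon_spec h1
    exact Or.inr (Or.inl ⟨_, hε.1, hε.2, rfl⟩)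
  · rw [if_neg h1]
    by_cases h2 : ∃ p : List Bool × ℕ, p.1.length = κ m ∧ p.2 ∈ zhandryModuli (2 ^ ℓ m) ∧
        W m = modTbl F ℓ m p.1 p.2
    · rw [if_pos h2]
      have hε := Classical.epsilon_spec h2
      exact Or.inr (Or.inr ⟨_, _, hε.1, hε.2.1, hε.2.2, rfl⟩)
    · rw [if_neg h2]
      rcases hW with h | ⟨k, hk, hWk⟩ | ⟨k, a, hk, ha, hWk⟩
      · exact Or.inl ⟨h, rfl⟩
      · exact absurd ⟨k, hk, hWk⟩ h1
      · exact absurd ⟨(k, a), hk, ha, hWk⟩ h2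

/-- **The advice for input length `t`**: the records of the levels `0, …, t`. [cite: AroraBarak2009, Def. 6.16] -/
def advOf (F : FunctionEnsemble) (κ ℓ : ℕ → ℕ) (W : Tables ℓ) (t : ℕ) : List Bool :=
  body ((List.range (t + 1)).map (recOf F κ ℓ W))

/-- Record `m ≤ t` of the advice (`HashBricks.nthItemFn_body`). [folklore] -/
theorem nthItemFn_advOf (W : Tables ℓ) {m t : ℕ} (h : m ≤ t) :
    nthItemFn (boolPair (ones m) (advOf F κ ℓ W t)) = recOf F κ ℓ W m := by
  rw [advOf, nthItemFn_body, List.getD_eq_getElem _ _ (by simpa using Nat.lt_succ_of_le h)]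
  simp [List.getElem_map, List.getElem_range]

/-! ### The evaluator: parsing the header -/

/-- `1^m`, the level of the query `s = 1^m 0 1^j 0 x` (input `⟨s, advice⟩`). [folklore] -/
def mF : List Bool → List Bool := onesPrefixFn ∘ fstF
/-- `1^j 0 x`. [folklore] -/
def r1F : List Bool → List Bool := afterZeroFn ∘ fstF
/-- `1^j`, the bit position. [folklore] -/
def jF : List Bool → List Bool := onesPrefixFn ∘ r1F
/-- `x`, the argument. [folklore] -/
def xF : List Bool → List Bool := afterZeroFn ∘ r1F
/-- The re-encoded header `1^m 0 1^j 0 x` of the parsed fields. [folklore] -/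
def reencF : List Bool → List Bool :=
  concatFn ∘ fanoutFn mF (List.cons false ∘ concatFn ∘ fanoutFn jF (List.cons false ∘ xF))
/-- `[s is a header]`: the query equals the re-encoding of its parse. [folklore] -/
def validF : List Bool → List Bool := eqPairFn ∘ fanoutFn fstF reencF

/-- Parsing a header. [folklore] -/
theorem parse_hdr (m j : ℕ) (x A : List Bool) :
    mF (boolPair (hdr m j x) A) = ones m ∧ jF (boolPair (hdr m j x) A) = ones j ∧
      xF (boolPair (hdr m j x) A) = x := by
  simp [mF, jF, xF, r1F, hdr]

/-- The validity bit in general: the query against the header of its parse. [folklore] -/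
theorem validF_boolPair (s A : List Bool) :
    validF (boolPair s A) =
      [decide (s = hdr (splitOnes s).1 (splitOnes (splitOnes s).2).1 (splitOnes (splitOnes s).2).2)] := by
  simp [validF, reencF, mF, jF, xF, r1F, hdr, onesPrefixFn, afterZeroFn, ones, eqPairFn_boolPair,
    concatFn_boolPair, Function.comp_apply]

/-- A header is valid. [folklore] -/
theorem validF_hdr (m j : ℕ) (x A : List Bool) : validF (boolPair (hdr m j x) A) = [true] := by
  rw [validF_boolPair]
  simp [hdr]

/-- A valid query is a header (namely the header of its parse). [folklore] -/
theorem eq_hdr_of_validF {s A : List Bool} (h : validF (boolPair s A) = [true]) :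
    ∃ m j x, s = hdr m j x := by
  rw [validF_boolPair] at h
  simp only [List.cons.injEq, and_true, decide_eq_true_eq] at h
  exact ⟨_, _, _, h⟩

/-! ### The evaluator: the record of the level and the value -/

/-- Record `m` of the advice. [folklore] -/
def recF : List Bool → List Bool := nthItemFn ∘ fanoutFn mF sndF
/-- The tag of the record. [folklore] -/
def tagF : List Bool → List Bool := nthF 0 ∘ recF
/-- The block length `1^{ℓ m}` of the record. [folklore] -/
def lenF : List Bool → List Bool := nthF 1 ∘ recF
/-- The key of the record. [folklore] -/
def keyF : List Bool → List Bool := nthF 2 ∘ recF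
/-- The modulus (binary) of the record. [folklore] -/
def modF : List Bool → List Bool := sndPow 2 ∘ recF
/-- `[|x| = ℓ m]`. [folklore] -/
def lenOkF : List Bool → List Bool := eqPairFn ∘ fanoutFn (onesFn ∘ xF) lenF
/-- `x mod a` padded to `ℓ m` bits (`modReduce`). [cite: AaronsonChen2017, §7.2] -/
def xredF : List Bool → List Bool :=
  takeFn ∘ fanoutFn lenF (concatFn ∘ fanoutFn (remFn ∘ fanoutFn xF modF) (Kannan.zerosFn ∘ lenF))
/-- The argument record `⟨1^m, ⟨k, x⟩⟩` of the machine of `F` (`PRP^raw`). [folklore] -/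
def finRawF : List Bool → List Bool := fanoutFn mF (fanoutFn keyF xF)
/-- The argument record `⟨1^m, ⟨k, x mod a⟩⟩` of the machine of `F` (`PRF^mod`). [folklore] -/
def finModF : List Bool → List Bool := fanoutFn mF (fanoutFn keyF xredF)
/-- The table value: `F m k x` or `F m k (x mod a)` by the tag. [cite: AaronsonChen2017, §7.2] -/
def fvalF (F : FunctionEnsemble) : List Bool → List Bool :=
  iteFn (headBitFn ∘ tagF) (strFn F ∘ finModF) (strFn F ∘ finRawF)
/-- **The level value of `x`** (`levelValue`): `x` off the block length or for the identity,
otherwise the table value. [folklore] -/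
def valueF (F : FunctionEnsemble) : List Bool → List Bool :=
  iteFn lenOkF (iteFn (isNilFn ∘ tagF) xF (fvalF F)) xF
/-- Bit `j` of the value (`(v ⇂ j) ↾ 1`). [folklore] -/
def bitF (F : FunctionEnsemble) : List Bool → List Bool := bitAtFn ∘ fanoutFn jF (valueF F)
/-- **The output bit**: the query is a header AND bit `j` of the level value is `1`. [folklore] -/
def outF (F : FunctionEnsemble) : List Bool → List Bool :=
  andFn validF (eqPairFn ∘ fanoutFn (bitF F) (fun _ => [true]))

/-! ### The evaluator is polynomial-time (brick algebra) -/

/-- `mF ∈ FP`. [folklore] -/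
theorem mF_mem_FP : mF ∈ FP := comp_mem_FP onesPrefixFn_mem_FP fstF_mem_FP
/-- `r1F ∈ FP`. [folklore] -/
theorem r1F_mem_FP : r1F ∈ FP := comp_mem_FP afterZeroFn_mem_FP fstF_mem_FP
/-- `jF ∈ FP`. [folklore] -/
theorem jF_mem_FP : jF ∈ FP := comp_mem_FP onesPrefixFn_mem_FP r1F_mem_FP
/-- `xF ∈ FP`. [folklore] -/
theorem xF_mem_FP : xF ∈ FP := comp_mem_FP afterZeroFn_mem_FP r1F_mem_FP

/-- `reencF ∈ FP`. [folklore] -/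
theorem reencF_mem_FP : reencF ∈ FP :=
  comp_mem_FP concatFn_mem_FP (fanoutFn_mem_FP mF_mem_FP (comp_mem_FP (cons_mem_FP false)
    (comp_mem_FP concatFn_mem_FP (fanoutFn_mem_FP jF_mem_FP (comp_mem_FP (cons_mem_FP false) xF_mem_FP)))))

/-- `validF ∈ FP`. [folklore] -/
theorem validF_mem_FP : validF ∈ FP := comp_mem_FP eqPairFn_mem_FP (fanoutFn_mem_FP fstF_mem_FP reencF_mem_FP)
/-- `recF ∈ FP`. [folklore] -/
theorem recF_mem_FP : recF ∈ FP := comp_mem_FP nthItemFn_mem_FP (fanoutFn_mem_FP mF_mem_FP sndF_mem_FP)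
/-- `tagF ∈ FP`. [folklore] -/
theorem tagF_mem_FP : tagF ∈ FP := comp_mem_FP (nthF_mem_FP 0) recF_mem_FP
/-- `lenF ∈ FP`. [folklore] -/
theorem lenF_mem_FP : lenF ∈ FP := comp_mem_FP (nthF_mem_FP 1) recF_mem_FP
/-- `keyF ∈ FP`. [folklore] -/
theorem keyF_mem_FP : keyF ∈ FP := comp_mem_FP (nthF_mem_FP 2) recF_mem_FP
/-- `modF ∈ FP`. [folklore] -/
theorem modF_mem_FP : modF ∈ FP := comp_mem_FP (sndPow_mem_FP 2) recF_mem_FP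
/-- `lenOkF ∈ FP`. [folklore] -/
theorem lenOkF_mem_FP : lenOkF ∈ FP :=
  comp_mem_FP eqPairFn_mem_FP (fanoutFn_mem_FP (comp_mem_FP onesFn_mem_FP xF_mem_FP) lenF_mem_FP)

/-- `xredF ∈ FP`. [folklore] -/
theorem xredF_mem_FP : xredF ∈ FP :=
  comp_mem_FP takeFn_mem_FP (fanoutFn_mem_FP lenF_mem_FP (comp_mem_FP concatFn_mem_FP
    (fanoutFn_mem_FP (comp_mem_FP remFn_mem_FP (fanoutFn_mem_FP xF_mem_FP modF_mem_FP))
      (comp_mem_FP Kannan.zerosFn_mem_FP lenF_mem_FP))))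

/-- `finRawF ∈ FP`. [folklore] -/
theorem finRawF_mem_FP : finRawF ∈ FP := fanoutFn_mem_FP mF_mem_FP (fanoutFn_mem_FP keyF_mem_FP xF_mem_FP)
/-- `finModF ∈ FP`. [folklore] -/
theorem finModF_mem_FP : finModF ∈ FP := fanoutFn_mem_FP mF_mem_FP (fanoutFn_mem_FP keyF_mem_FP xredF_mem_FP)

/-- `fvalF F ∈ FP` when the evaluation map of `F` is polynomial-time. [folklore] -/
theorem fvalF_mem_FP (hF : IsEfficientFamily F κ ℓ ℓ) : fvalF F ∈ FP :=
  iteFn_mem_FP (comp_mem_FP headBitFn_mem_FP tagF_mem_FP)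
    (comp_mem_FP (strFn_mem_FP hF.1) finModF_mem_FP) (comp_mem_FP (strFn_mem_FP hF.1) finRawF_mem_FP)

/-- `valueF F ∈ FP`. [folklore] -/
theorem valueF_mem_FP (hF : IsEfficientFamily F κ ℓ ℓ) : valueF F ∈ FP :=
  iteFn_mem_FP lenOkF_mem_FP (iteFn_mem_FP (comp_mem_FP isNilFn_mem_FP tagF_mem_FP) xF_mem_FP (fvalF_mem_FP hF))
    xF_mem_FP

/-- `bitF F ∈ FP`. [folklore] -/
theorem bitF_mem_FP (hF : IsEfficientFamily F κ ℓ ℓ) : bitF F ∈ FP :=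
  comp_mem_FP bitAtFn_mem_FP (fanoutFn_mem_FP jF_mem_FP (valueF_mem_FP hF))

/-- **`outF F ∈ FP`**: the whole evaluator is polynomial-time. [cite: AroraBarak2009, §1.3] -/
theorem outF_mem_FP (hF : IsEfficientFamily F κ ℓ ℓ) : outF F ∈ FP :=
  andFn_mem_FP validF_mem_FP
    (comp_mem_FP eqPairFn_mem_FP (fanoutFn_mem_FP (bitF_mem_FP hF) (const_mem_FP _)))

/-- **The decided language `{w | outF w = 1}` is in `P`.** [cite: AroraBarak2009, §1.3] -/
theorem outLang_mem_P (hF : IsEfficientFamily F κ ℓ ℓ) :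
    ({w | outF F w = [true]} : Language Bool) ∈ Classes.P :=
  setOf_apply_eq_apply_mem_P (outF_mem_FP hF) (const_mem_FP [true])

/-- Bit `j` of a bit string, read as "`(v ⇂ j) ↾ 1 = [1]`". [folklore] -/
theorem decide_take_one_drop_eq (v : List Bool) (j : ℕ) :
    decide ((v.drop j).take 1 = [true]) = v.getD j false := by
  by_cases hj : j < v.length
  · rw [List.take_one_drop_eq_of_lt_length hj, List.getD_eq_getElem _ _ hj, List.get_eq_getElem]
    cases v[j] <;> rfl
  · push Not at hj
    rw [List.drop_eq_nil_of_le hj, List.take_nil, List.getD_eq_default _ _ hj]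
    decide

/-! ### Semantics of the evaluator on `⟨hdr m j x, advice⟩` -/

section Semantics

variable (W : Tables ℓ) {m t : ℕ} (j : ℕ) (x : List Bool)

/-- The fetched record is record `m`. [folklore] -/
theorem recF_hdr (hm : m ≤ t) :
    recF (boolPair (hdr m j x) (advOf F κ ℓ W t)) = recOf F κ ℓ W m := by
  have hp := parse_hdr m j x (advOf F κ ℓ W t)
  rw [recF, Function.comp_apply, fanoutFn_apply, hp.1, sndF_boolPair]
  exact nthItemFn_advOf W hm

/-- The fields of an identity record. [folklore] -/
theorem fields_recId (L : ℕ) :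
    nthF 0 (recId L) = [] ∧ nthF 1 (recId L) = ones L := by
  simp [recId]

/-- The fields of a `PRP^raw` record. [folklore] -/
theorem fields_recRaw (L : ℕ) (k : List Bool) :
    nthF 0 (recRaw L k) = [false] ∧ nthF 1 (recRaw L k) = ones L ∧ nthF 2 (recRaw L k) = k := by
  simp [recRaw, nthF]

/-- The fields of a `PRF^mod` record. [folklore] -/
theorem fields_recMod (L : ℕ) (k : List Bool) (a : ℕ) :
    nthF 0 (recMod L k a) = [true] ∧ nthF 1 (recMod L k a) = ones L ∧ nthF 2 (recMod L k a) = k ∧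
      sndPow 2 (recMod L k a) = encodeNat a := by
  simp [recMod, nthF, sndPow]

/-- The length test against a record whose block-length field is `1^L`. [folklore] -/
theorem lenOkF_eq {w : List Bool} {L : ℕ} (hx : xF w = x) (hL : lenF w = ones L) :
    lenOkF w = [decide (x.length = L)] := by
  rw [lenOkF, Function.comp_apply, fanoutFn_apply, Function.comp_apply, hx, hL, eqPairFn_boolPair]
  simp [onesFn, ones, OracleCompose.unaryEncodeNat_eq_replicate]

/-- **The reduced argument is `x mod a` on `ℓ m` bits** (`modReduce`), for a modulus `a ≤ 2^{L}`
with `0 < a`. [cite: AaronsonChen2017, §7.2] -/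
theorem xredF_spec {w : List Bool} {L a : ℕ} (hx : xF w = x) (hL : lenF w = ones L)
    (hmod : modF w = encodeNat a) (ha : 0 < a) (haL : a ≤ 2 ^ L) :
    xredF w = modReduce L a x := by
  rw [xredF, Function.comp_apply, fanoutFn_apply, hL, takeFn_boolPair, Function.comp_apply,
    fanoutFn_apply, concatFn_boolPair, Function.comp_apply, fanoutFn_apply, hx, hmod, remFn_boolPair,
    bitsToNat_encodeNat, Function.comp_apply, hL, Kannan.zerosFn_apply]
  rw [show (ones L).length = L by simp [ones]]
  exact take_encodeNat_append_replicate (lt_of_lt_of_le (Nat.mod_lt _ ha) haL)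

/-- **The value is the level value** (`levelValue W m x`) for an `IsACTable` level `m ≤ t`. [folklore] -/
theorem valueF_hdr (hF : IsEfficientFamily F κ ℓ ℓ) (hW : IsACTable F κ ℓ m (W m)) (hm : m ≤ t) :
    valueF F (boolPair (hdr m j x) (advOf F κ ℓ W t)) = levelValue W m x := by
  set w := boolPair (hdr m j x) (advOf F κ ℓ W t) with hw
  have hp := parse_hdr m j x (advOf F κ ℓ W t)
  have hrec : recF w = recOf F κ ℓ W m := recF_hdr W j x hm
  have htag : tagF w = nthF 0 (recOf F κ ℓ W m) := by rw [tagF, Function.comp_apply, hrec]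
  have hlen : lenF w = nthF 1 (recOf F κ ℓ W m) := by rw [lenF, Function.comp_apply, hrec]
  have hkey : keyF w = nthF 2 (recOf F κ ℓ W m) := by rw [keyF, Function.comp_apply, hrec]
  have hmodf : modF w = sndPow 2 (recOf F κ ℓ W m) := by rw [modF, Function.comp_apply, hrec]
  rcases recOf_cases W m hW with ⟨hid, hr⟩ | ⟨k, hk, hWk, hr⟩ | ⟨k, a, hk, ha, hWk, hr⟩
  · -- identity level
    have hL : lenF w = ones (ℓ m) := by rw [hlen, hr, (fields_recId _).2]
    have hT : tagF w = [] := by rw [htag, hr, (fields_recId _).1]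
    have hval : levelValue W m x = x := by
      unfold levelValue
      split_ifs with h
      · rw [hid]; rfl
      · rfl
    rw [hval, valueF]
    rw [iteFn_apply (b := decide (x.length = ℓ m)) (lenOkF_eq x hp.2.2 hL)]
    split_ifs
    · rw [iteFn_apply_true (by rw [Function.comp_apply, hT]; rfl), hp.2.2]
    · exact hp.2.2
  · -- `PRP^raw` level with key `k`
    have hL : lenF w = ones (ℓ m) := by rw [hlen, hr, (fields_recRaw _ _).2.1]
    have hT : tagF w = [false] := by rw [htag, hr, (fields_recRaw _ _).1]
    have hK : keyF w = k := by rw [hkey, hr, (fields_recRaw _ _).2.2]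
    rw [valueF, iteFn_apply (b := decide (x.length = ℓ m)) (lenOkF_eq x hp.2.2 hL)]
    by_cases hxl : x.length = ℓ m
    · rw [if_pos (by simp [hxl]), iteFn_apply_false (by rw [Function.comp_apply, hT]; rfl), fvalF,
        iteFn_apply_false (by rw [Function.comp_apply, hT]; rfl), Function.comp_apply, finRawF,
        fanoutFn_apply, fanoutFn_apply, hp.1, hK, hp.2.2, strFn_boolPair]
      rw [show (ones m).length = m by simp [ones]]
      have hFl : (F m k x).length = ℓ m := hF.2.2 m k x hk hxl
      unfold levelValue
      rw [dif_pos hxl, hWk]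
      simp [rawTbl, toTbl, hFl]
    · rw [if_neg (by simp [hxl]), hp.2.2]
      unfold levelValue
      rw [dif_neg hxl]
  · -- `PRF^mod` level with key `(k, a)`
    have hL : lenF w = ones (ℓ m) := by rw [hlen, hr, (fields_recMod _ _ _).2.1]
    have hT : tagF w = [true] := by rw [htag, hr, (fields_recMod _ _ _).1]
    have hK : keyF w = k := by rw [hkey, hr, (fields_recMod _ _ _).2.2.1]
    have hM : modF w = encodeNat a := by rw [hmodf, hr, (fields_recMod _ _ _).2.2.2]
    have hxred : xredF w = modReduce (ℓ m) a x :=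
      xredF_spec x hp.2.2 hL hM (pos_of_mem_zhandryModuli ha) (le_of_mem_zhandryModuli ha)
    rw [valueF, iteFn_apply (b := decide (x.length = ℓ m)) (lenOkF_eq x hp.2.2 hL)]
    by_cases hxl : x.length = ℓ m
    · rw [if_pos (by simp [hxl]), iteFn_apply_false (by rw [Function.comp_apply, hT]; rfl), fvalF,
        iteFn_apply_true (by rw [Function.comp_apply, hT]; rfl), Function.comp_apply, finModF,
        fanoutFn_apply, fanoutFn_apply, hp.1, hK, hxred, strFn_boolPair]
      rw [show (ones m).length = m by simp [ones]]
      have hFl : (F m k (modReduce (ℓ m) a x)).length = ℓ m := length_prfMod hF m hk a x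
      unfold levelValue
      rw [dif_pos hxl, hWk]
      simp [modTbl, toTbl, prfMod, hFl]
    · rw [if_neg (by simp [hxl]), hp.2.2]
      unfold levelValue
      rw [dif_neg hxl]

/-- **Semantics of the output bit on a header**: bit `j` of the level value.
[cite: AaronsonChen2017, Thm. 7.6 (proof, p. 30)] -/
theorem outF_hdr (hF : IsEfficientFamily F κ ℓ ℓ) (hW : IsACTable F κ ℓ m (W m)) (hm : m ≤ t) :
    outF F (boolPair (hdr m j x) (advOf F κ ℓ W t)) = [(levelValue W m x).getD j false] := by
  have hp := parse_hdr m j x (advOf F κ ℓ W t)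
  have hv : valueF F (boolPair (hdr m j x) (advOf F κ ℓ W t)) = levelValue W m x :=
    valueF_hdr W j x hF hW hm
  have hbit : bitF F (boolPair (hdr m j x) (advOf F κ ℓ W t)) = ((levelValue W m x).drop j).take 1 := by
    rw [bitF, Function.comp_apply, fanoutFn_apply, hp.2.1, hv, bitAtFn_boolPair]
    rw [show (ones j).length = j by simp [ones]]
  have hcmp : (eqPairFn ∘ fanoutFn (bitF F) fun _ => [true]) (boolPair (hdr m j x) (advOf F κ ℓ W t)) =
      [decide (((levelValue W m x).drop j).take 1 = [true])] := by
    rw [Function.comp_apply, fanoutFn_apply, hbit, eqPairFn_boolPair]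
  have hval := validF_hdr m j x (advOf F κ ℓ W t)
  rw [outF]
  rw [andFn_apply hval hcmp]
  rw [Bool.true_and, decide_take_one_drop_eq]

end Semantics

end ACEval

open ACEval

variable {F : FunctionEnsemble} {κ ℓ : ℕ → ℕ}

/-! ### The advice has polynomial length -/

/-- The length of a record. [folklore] -/
theorem length_recOf_le (W : Tables ℓ) (m : ℕ)
    (hW : IsACTable F κ ℓ m (W m)) :
    (recOf F κ ℓ W m).length ≤ 3 * ℓ m + 2 * κ m + 12 := by
  rcases recOf_cases W m hW with ⟨-, hr⟩ | ⟨k, hk, -, hr⟩ | ⟨k, a, hk, ha, -, hr⟩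
  · rw [hr, recId, length_boolPair, length_boolPair, length_boolPair]
    simp [ones]; omega
  · rw [hr, recRaw, length_boolPair, length_boolPair, length_boolPair]
    simp [ones, hk]; omega
  · rw [hr, recMod, length_boolPair, length_boolPair, length_boolPair]
    have hea : (encodeNat a).length ≤ ℓ m := by
      have h2 := (prime_of_mem_zhandryModuli ha).two_le
      have hlt : a < 2 ^ ℓ m :=
        lt_of_lt_of_le (by nlinarith) (sq_le_of_mem_zhandryModuli ha)
      rw [TM2Pass.length_encodeNat_eq_size]
      exact Nat.size_le.2 hlt
    simp [ones, hk]; omega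

/-- **The advice has polynomial length**: with `q` the bound of `IsEfficientFamily` on `κ, ℓ`,
`|advOf W t| ≤ (t + 1) · (10 q(t) + 26)`. [cite: AroraBarak2009, Def. 6.16] -/
theorem length_advOf_le (W : Tables ℓ) (hW : ∀ n, IsACTable F κ ℓ n (W n))
    {q : Polynomial ℕ} (hq : ∀ n, κ n ≤ q.eval n ∧ ℓ n ≤ q.eval n ∧ ℓ n ≤ q.eval n) (t : ℕ) :
    (advOf F κ ℓ W t).length ≤ ((X + 1) * (10 * q + 26)).eval t := by
  rw [advOf, length_body, List.map_map]
  have hterm : ∀ m ∈ List.range (t + 1),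
      ((fun r : List Bool => 2 * r.length + 2) ∘ recOf F κ ℓ W) m ≤ 10 * q.eval t + 26 := by
    intro m hm
    have hmt : m ≤ t := Nat.lt_succ_iff.1 (List.mem_range.1 hm)
    have h1 := length_recOf_le W m (hW m)
    have h2 : ℓ m ≤ q.eval t := (hq m).2.1.trans (TM2Iter.eval_mono q hmt)
    have h3 : κ m ≤ q.eval t := (hq m).1.trans (TM2Iter.eval_mono q hmt)
    simp only [Function.comp_apply]
    omega
  have hev : ((X + 1) * (10 * q + 26)).eval t = (t + 1) * (10 * q.eval t + 26) := by
    simp only [Polynomial.eval_mul, Polynomial.eval_add, Polynomial.eval_X, Polynomial.eval_one,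
      Polynomial.eval_ofNat]
  rw [hev]
  calc ((List.range (t + 1)).map ((fun r : List Bool => 2 * r.length + 2) ∘ recOf F κ ℓ W)).sum
      ≤ ((List.range (t + 1)).map fun _ => 10 * q.eval t + 26).sum :=
        List.sum_le_sum (fun m hm => hterm m hm)
    _ = (t + 1) * (10 * q.eval t + 26) := by
        rw [List.map_const', List.sum_replicate, List.length_range, smul_eq_mul]

/-! ### Assembly -/

/-- **`acLang W ∈ P/poly-advice`** for an efficiently computable `F` and an `IsACTable` assignment:
the language `{w | outF w = 1} ∈ P`, the advice `advOf W`, and the equivalence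
`s ∈ acLang W ↔ ⟨s, advOf W |s|⟩` accepted (a header of level `m` has length `> m`, so its record
is in the advice; non-headers are rejected and are not in `acLang W`).
[cite: AroraBarak2009, Def. 6.16] [cite: AaronsonChen2017, Thm. 7.6 (proof, p. 30)] -/
theorem acLang_mem_polyAdvice_P (hF : IsEfficientFamily F κ ℓ ℓ) (W : Tables ℓ)
    (hW : ∀ n, IsACTable F κ ℓ n (W n)) : acLang W ∈ polyAdvice Classes.P := by
  obtain ⟨q, hq⟩ := hF.2.1
  refine ⟨{w | outF F w = [true]}, outLang_mem_P hF, advOf F κ ℓ W, (X + 1) * (10 * q + 26),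
    length_advOf_le W hW hq, fun s => ?_⟩
  change s ∈ acLang W ↔ outF F (boolPair s (advOf F κ ℓ W s.length)) = [true]
  constructor
  · rintro ⟨m, j, x, rfl, hv⟩
    rw [outF_hdr W j x hF (hW m) (lt_length_hdr m j x).le, hv]
  · intro h
    -- a valid query is a header
    have hvalid : validF (boolPair s (advOf F κ ℓ W s.length)) = [true] := by
      rw [outF] at h
      obtain ⟨b, hb⟩ : ∃ b, validF (boolPair s (advOf F κ ℓ W s.length)) = [b] := by
        rw [validF_boolPair]; exact ⟨_, rfl⟩
      obtain ⟨b', hb'⟩ : ∃ b', (eqPairFn ∘ fanoutFn (bitF F) fun _ => [true])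
          (boolPair s (advOf F κ ℓ W s.length)) = [b'] := by
        rw [Function.comp_apply, fanoutFn_apply, eqPairFn_boolPair]; exact ⟨_, rfl⟩
      rw [andFn_apply hb hb'] at h
      cases b
      · simp at h
      · exact hb
    obtain ⟨m, j, x, rfl⟩ := eq_hdr_of_validF hvalid
    rw [outF_hdr W j x hF (hW m) (lt_length_hdr m j x).le] at h
    exact (hdr_mem_acLang W m j x).2 (by simpa using h)

/-- **Discharge of the `P/poly` leaf of Thm. 7.6** ("each `f_n` has a polynomial-size circuit, and
consequently `O ∈ P/poly`"): through `P/poly = P/poly-advice` (`PPoly_eq_polyAdvice_P_holds`).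
[cite: AaronsonChen2017, Thm. 7.6 (proof, last sentence, p. 30)] [cite: AroraBarak2009, Thm. 6.18] -/
theorem aaronsonChen2017_thm76_ppoly_holds : aaronsonChen2017_thm76_ppoly := by
  intro F κ ℓ hF _ W hW
  rw [PPoly_eq_polyAdvice_P_holds]
  exact acLang_mem_polyAdvice_P hF.isEfficientFamily W hW

/-- Hence `aaronsonChen2017_thm76_of_prp` from the three remaining leaves (Lemma 7.5 (1) for
`PRF^mod`, the quantum machine, the `BPP^O`-to-adversary compilation), the switching lemma and the
`P/poly` leaf being discharged (`aaronsonChen2017_lem75_prp_isPRF_holds` is fed by the caller).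
[cite: AaronsonChen2017, Thm. 7.6 (proof, p. 30)] -/
theorem aaronsonChen2017_thm76_of_prp_of_leaves₃ (h₁ : aaronsonChen2017_lem75_prp_isPRF)
    (h₂ : aaronsonChen2017_lem75_prfMod_isPRF) (hq : aaronsonChen2017_lem75_quantum)
    (hc : acLang_bppCompiles) : aaronsonChen2017_thm76_of_prp :=
  aaronsonChen2017_thm76_of_prp_of_leaves h₁ h₂ hq hc aaronsonChen2017_thm76_ppoly_holds

end Literature.Barriers.QuantumAdvantage

end
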